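import Literature.NumberTheory.Rogawski1990.ArchEPGeneratorRegular                -- ★ p852141: `chartOrbGLoc_ofReal_re_pos` (pattern) and its whole import cone (engine ★ `contDiffOn_chartOrbGLoc_of_uniformlyProper`, D4b-1, D1c, positivity tokens)
import Literature.NumberTheory.Automorphic.UnitaryFormGroupTestFunctionExtension   -- ★ `isClosedEmbedding_coe_unitaryGroupOfForm`
import HarnessLib

/-!
# The compact-wall representative: compact stabiliser of the odd line and uniform properness across the compact wall

Brick (8e′)(γ) of the N8-INNER road (SIGSHEET (8e′) v1, LH1-p01 (g12), §(γ); LHref-N BOX #44∕#45∕#55).  At a complex place `w`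
of the real diagonal frame `diag(α)` (`a_i = re σ_w α_i ≠ 0`) let `τ = lineOf (formSign L α w)` be the slot ↦ line map and `ℓ = τ 2`
the ODD line: the two other lines carry the SAME sign (★ `sign_apply_lineOf`; trivially at a definite place), so the
form-orthogonal plane of `e_ℓ` is DEFINITE and

* §1 **`isCompact_stabilizer_single_lineOf_two`** — `Stab(e_ℓ) ≤ U(diag a)_w` is COMPACT (`≅ U(2)`): for `g ∈ Stab(e_ℓ)` unitarity
  `gᴴ·diag(a)·g = diag(a)` forces row and column `ℓ` of `g` to be `e_ℓ` and `Σ_{m ≠ ℓ} a_m ‖g_{m i}‖² = a_i` (`i ≠ ℓ`), all terms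
  of one sign, so every entry of `g` is bounded; the image of `Stab(e_ℓ)` under the closed embedding `U(diag a)_w ↪ M₃(ℂ)`
  (★ `isClosedEmbedding_coe_unitaryGroupOfForm`) is closed and lies in a compact cube.
* §2 **`uniformlyProper_gprimeBlockAt_cpt_of_slot_two_simple`** — the `hprop` binder of ★ `contDiffOn_chartOrbGLoc_of_uniformlyProper`
  VERBATIM on `U₂ = {cw | ∀ j ≠ 2, e^{i cw 2} ≠ e^{i cw j}}` (slot `2` simple, slots `0, 1` free to COLLIDE — the compact wall),
  modulo `chartTorusGLoc`: ★ D1c `exists_isCompact_mul_circleDiagonal_of_ne` (one compact `C′` with `y ∈ C′ · Stab(e_ℓ)`) + §1.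
* §3 corollaries: **`contDiffOn_chartOrbGLoc_cpt_of_slot_two_simple`** (the one-place functional is `C^∞` on `U₂`, i.e. ACROSS the
  compact wall) and **`chartOrbGLoc_ofReal_re_pos_of_slot_two_simple`** (positivity at a point of `U₂`), the ★ proofs of
  `contDiffOn_chartOrbGLoc_cpt_of_injective` ∕ `chartOrbGLoc_ofReal_re_pos` with §2 in place of D4b-1.

HONEST LABEL: count-neutral; HC_CM is proved only modulo the 7 printed citations (2 remaining: hLiu418 = `stmt-HodgeConjecture-24832`,
h413 = `stmt-HodgeConjecture-24833`) until rung 0 closes.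

## References
* [Rogawski1990] J. D. Rogawski, *Automorphic Representations of Unitary Groups in Three Variables*, Ann. of Math. Stud. 123 (1990), §4.12 Lemma 4.12.1 p. 66, §8.2 pp. 114, 122–123
  (the wall `γ₂ → γ₀`: at the compact-wall representative the centraliser `U(2) × U(1)` is compact), §3.6 p. 31.
* [HarishChandra1970] Harish-Chandra (notes by G. van Dijk), *Harmonic Analysis on Reductive p-adic Groups*, LNM 162 (1970), Part I §3 Lemma 22.
* [DeitmarEchterhoff2014] A. Deitmar, S. Echterhoff, *Principles of Harmonic Analysis*, 2nd ed. (2014), Lemma 9.3.3, Thm. 1.5.3.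
* [Shelstad1979] D. Shelstad, *Characters and inner forms of a quasi-split group over ℝ*, Compositio Math. 39 (1979), §4 pp. 22–23.
-/

set_option autoImplicit false

noncomputable section

open MeasureTheory MeasureTheory.Measure NumberField NumberField.InfinitePlace Matrix Complex Topology Metric Set Function MulAction
open Literature.MeasureTheory.Group Literature.NumberTheory.Automorphic Literature.NumberTheory.Rogawski1990
open scoped MatrixGroups Matrix ContDiff Classical ENNReal Pointwise Matrix.Norms.Operator

namespace Literature.NumberTheory.Automorphic.UnitaryGroup

/-! ## §1 The stabiliser of the odd basis line is compact -/

section Stabilizer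

variable (L : Type) [Field L] (α : Fin 3 → L) (w : {w : InfinitePlace L // IsComplex w})

/-- **Same sign off the odd line**: every slot `i ≠ lineOf s 2` carries the sign of `lineOf s 0` (definite place: all signs equal; indefinite place: ★ `sign_apply_lineOf`).
[cite: Rogawski1990, §3.6 p. 31] -/
theorem formSign_eq_of_ne_lineOf_two (hα : ∀ i, α i ≠ 0) (hreal : ∀ i, (w.1.embedding (α i)).im = 0) {i : Fin 3}
    (hi : i ≠ lineOf (formSign L α w) 2) : formSign L α w i = formSign L α w (lineOf (formSign L α w) 0) := by
  set s : Fin 3 → SignType := formSign L α w with hs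
  have hne : ∀ j, s j ≠ 0 := fun j h => formRe_ne_zero hα hreal j (sign_eq_zero_iff.1 h)
  by_cases hind : s 0 = s 1 ∧ s 1 = s 2
  · have hall : ∀ j, s j = s 0 := by
      intro j
      fin_cases j
      · rfl
      · exact hind.1.symm
      · exact (hind.1.trans hind.2).symm
    rw [hall i, hall (lineOf s 0)]
  · obtain ⟨h10, -⟩ := sign_apply_lineOf (hne 0) (hne 1) (hne 2) hind
    have hk : (lineOf s).symm i ≠ 2 := fun h => hi (by rw [← h, Equiv.apply_symm_apply])
    have h3 : (lineOf s).symm i = 0 ∨ (lineOf s).symm i = 1 := by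
      have h' : (lineOf s).symm i = 0 ∨ (lineOf s).symm i = 1 ∨ (lineOf s).symm i = 2 := by
        generalize (lineOf s).symm i = k
        fin_cases k <;> simp
      rcases h' with h | h | h
      · exact Or.inl h
      · exact Or.inr h
      · exact absurd h hk
    rcases h3 with h | h
    · rw [show i = lineOf s 0 by rw [← h, Equiv.apply_symm_apply]]
    · rw [show i = lineOf s 1 by rw [← h, Equiv.apply_symm_apply]]
      exact h10

/-- **The form is DEFINITE off the odd line**: `0 < a_m · a_i` for `m, i ≠ lineOf s 2` (`a = formRe`). [cite: Rogawski1990, §3.6 p. 31] -/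
theorem formRe_mul_formRe_pos_of_ne_lineOf_two (hα : ∀ i, α i ≠ 0) (hreal : ∀ i, (w.1.embedding (α i)).im = 0) {m i : Fin 3}
    (hm : m ≠ lineOf (formSign L α w) 2) (hi : i ≠ lineOf (formSign L α w) 2) : 0 < formRe L α w m * formRe L α w i := by
  have h1 : SignType.sign (formRe L α w m * formRe L α w i) = 1 := by
    rw [sign_mul]
    change formSign L α w m * formSign L α w i = 1
    rw [formSign_eq_of_ne_lineOf_two L α w hα hreal hm, formSign_eq_of_ne_lineOf_two L α w hα hreal hi]
    have hne : formSign L α w (lineOf (formSign L α w) 0) ≠ 0 := fun h => formRe_ne_zero hα hreal _ (sign_eq_zero_iff.1 h)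
    revert hne
    generalize formSign L α w (lineOf (formSign L α w) 0) = t
    revert t
    decide
  exact sign_eq_one_iff.1 h1

/-- **THE STABILISER OF THE ODD BASIS LINE IS COMPACT** (`Stab(e_ℓ) ≅ U(2)`, `ℓ = lineOf (formSign L α w) 2`): for `g ∈ Stab(e_ℓ)` the unitarity relation
`gᴴ · diag(a) · g = diag(a)` makes row and column `ℓ` equal to `e_ℓ` and gives `Σ_{m≠ℓ} a_m ‖g_{mi}‖² = a_i` with all terms of one sign (§1 definiteness), so the entries of
`g` are bounded; the image of `Stab(e_ℓ)` under the closed embedding `U(diag a)_w ↪ M₃(ℂ)` is closed and contained in a compact cube.  No Cartan decomposition.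
[cite: Rogawski1990, §8.2 pp. 122–123; §4.12 Lemma 4.12.1 p. 66] [cite: DeitmarEchterhoff2014, Lemma 9.3.3] -/
theorem isCompact_stabilizer_single_lineOf_two (hα : ∀ i, α i ≠ 0) (hreal : ∀ i, (w.1.embedding (α i)).im = 0) :
    IsCompact (MulAction.stabilizer ↥(archLocal L 3 (Matrix.diagonal α) w) (Pi.single (lineOf (formSign L α w) 2) (1 : ℂ) : Fin 3 → ℂ) :
      Set ↥(archLocal L 3 (Matrix.diagonal α) w)) := by
  set a : Fin 3 → ℝ := formRe L α w with ha
  set ℓ : Fin 3 := lineOf (formSign L α w) 2 with hℓ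
  have ha0 : ∀ i, a i ≠ 0 := formRe_ne_zero hα hreal
  have hJ : (Matrix.diagonal α).map w.1.embedding = Matrix.diagonal fun i => ((a i : ℝ) : ℂ) := diagonal_map_embedding_eq_of_real hreal
  have hpos : ∀ m i, m ≠ ℓ → i ≠ ℓ → 0 < a m * a i := fun m i hm hi => formRe_mul_formRe_pos_of_ne_lineOf_two L α w hα hreal hm hi
  -- a uniform lower bound `μ² ≤ a_m a_i` off `ℓ` and an upper bound `A` for `|a_i|`
  set μ : ℝ := min (min |a 0| |a 1|) |a 2| with hμ
  have hμ0 : 0 < μ := lt_min (lt_min (abs_pos.2 (ha0 0)) (abs_pos.2 (ha0 1))) (abs_pos.2 (ha0 2))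
  have hμle : ∀ k, μ ≤ |a k| := by
    intro k
    fin_cases k
    · exact (min_le_left _ _).trans (min_le_left _ _)
    · exact (min_le_left _ _).trans (min_le_right _ _)
    · exact min_le_right _ _
  set A : ℝ := |a 0| + |a 1| + |a 2| with hA
  have hAle : ∀ k, |a k| ≤ A := by
    intro k
    have h0 := abs_nonneg (a 0); have h1 := abs_nonneg (a 1); have h2 := abs_nonneg (a 2)
    fin_cases k
    · show |a 0| ≤ A; rw [hA]; linarith
    · show |a 1| ≤ A; rw [hA]; linarith
    · show |a 2| ≤ A; rw [hA]; linarith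
  have hA0 : 0 ≤ A := (abs_nonneg _).trans (hAle 0)
  set B : ℝ := max 1 (A / μ) with hB
  -- the closed embedding into `M₃(ℂ)`
  have hdet : ((Matrix.diagonal α).map w.1.embedding).det ≠ 0 := by
    rw [hJ, Matrix.det_diagonal]
    exact Finset.prod_ne_zero_iff.2 fun i _ => Complex.ofReal_ne_zero.2 (ha0 i)
  have he : IsClosedEmbedding (fun g : ↥(archLocal L 3 (Matrix.diagonal α) w) => ((g : GL (Fin 3) ℂ) : Matrix (Fin 3) (Fin 3) ℂ)) :=
    isClosedEmbedding_coe_unitaryGroupOfForm ((Matrix.diagonal α).map w.1.embedding) hdet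
  rw [he.isInducing.isCompact_iff]
  -- the compact cube
  have hcube' : IsCompact (Set.pi Set.univ fun _ : Fin 3 => Set.pi Set.univ fun _ : Fin 3 => Metric.closedBall (0 : ℂ) B) :=
    isCompact_univ_pi fun _ => isCompact_univ_pi fun _ => isCompact_closedBall _ _
  have hcube : IsCompact {X : Matrix (Fin 3) (Fin 3) ℂ | ∀ m i, ‖X m i‖ ≤ B} := by
    have e : {X : Matrix (Fin 3) (Fin 3) ℂ | ∀ m i, ‖X m i‖ ≤ B} =
        (Set.pi Set.univ fun _ : Fin 3 => Set.pi Set.univ fun _ : Fin 3 => Metric.closedBall (0 : ℂ) B : Set (Fin 3 → Fin 3 → ℂ)) := by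
      ext X
      constructor
      · intro h
        exact Set.mem_univ_pi.2 fun m => Set.mem_univ_pi.2 fun i => by
          rw [Metric.mem_closedBall, dist_zero_right]; exact h m i
      · intro h m i
        have hmi := Set.mem_univ_pi.1 (Set.mem_univ_pi.1 h m) i
        rwa [Metric.mem_closedBall, dist_zero_right] at hmi
    rw [e]
    exact hcube'
  refine hcube.of_isClosed_subset ?_ ?_
  · -- the image is `range ι ∩ {X | X e_ℓ = e_ℓ}`, closed
    have himg : (fun g : ↥(archLocal L 3 (Matrix.diagonal α) w) => ((g : GL (Fin 3) ℂ) : Matrix (Fin 3) (Fin 3) ℂ)) ''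
        (MulAction.stabilizer ↥(archLocal L 3 (Matrix.diagonal α) w) (Pi.single ℓ (1 : ℂ) : Fin 3 → ℂ) : Set ↥(archLocal L 3 (Matrix.diagonal α) w)) =
        Set.range (fun g : ↥(archLocal L 3 (Matrix.diagonal α) w) => ((g : GL (Fin 3) ℂ) : Matrix (Fin 3) (Fin 3) ℂ)) ∩
          {X : Matrix (Fin 3) (Fin 3) ℂ | X *ᵥ (Pi.single ℓ (1 : ℂ) : Fin 3 → ℂ) = Pi.single ℓ (1 : ℂ)} := by
      ext X
      constructor
      · rintro ⟨g, hg, rfl⟩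
        exact ⟨⟨g, rfl⟩, (MulAction.mem_stabilizer_iff.1 hg : ((g : GL (Fin 3) ℂ) : Matrix (Fin 3) (Fin 3) ℂ) *ᵥ (Pi.single ℓ (1 : ℂ) : Fin 3 → ℂ) = Pi.single ℓ 1)⟩
      · rintro ⟨⟨g, rfl⟩, hX⟩
        exact ⟨g, MulAction.mem_stabilizer_iff.2 hX, rfl⟩
    rw [himg]
    exact he.isClosed_range.inter (isClosed_eq (continuous_id.matrix_mulVec continuous_const) continuous_const)
  · rintro X ⟨g, hg, rfl⟩
    set G : Matrix (Fin 3) (Fin 3) ℂ := ((g : GL (Fin 3) ℂ) : Matrix (Fin 3) (Fin 3) ℂ) with hG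
    -- unitarity, entrywise: `Σ_m conj(G m i) a_m G m j = δ_{ij} a_i`
    have hmem := (mem_archLocal_iff_conjTranspose L 3 (Matrix.diagonal α) w (g : GL (Fin 3) ℂ)).1 g.2
    rw [hJ] at hmem
    have hent : ∀ i j, ∑ m, star (G m i) * ((a m : ℝ) : ℂ) * G m j = if i = j then ((a i : ℝ) : ℂ) else 0 := by
      intro i j
      have h := congrFun (congrFun hmem i) j
      rw [Matrix.mul_apply, Matrix.diagonal_apply] at h
      simp_rw [Matrix.mul_diagonal, Matrix.conjTranspose_apply] at h
      exact h
    -- column `ℓ` of `G` is `e_ℓ`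
    have hcol : ∀ m, G m ℓ = if m = ℓ then 1 else 0 := by
      intro m
      have h : G *ᵥ (Pi.single ℓ (1 : ℂ) : Fin 3 → ℂ) = Pi.single ℓ 1 := MulAction.mem_stabilizer_iff.1 hg
      have hm := congrFun h m
      rw [Matrix.mulVec_single_one] at hm
      rw [Pi.single_apply] at hm
      exact hm
    -- row `ℓ` of `G` vanishes off the diagonal
    have hrow : ∀ i, i ≠ ℓ → G ℓ i = 0 := by
      intro i hi
      have h := hent i ℓ
      rw [if_neg hi, Finset.sum_eq_single ℓ (fun m _ hm => by rw [hcol m, if_neg hm, mul_zero]) (fun h => absurd (Finset.mem_univ _) h),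
        hcol ℓ, if_pos rfl, mul_one] at h
      rcases mul_eq_zero.1 h with h1 | h1
      · exact star_eq_zero.1 h1
      · exact absurd h1 (Complex.ofReal_ne_zero.2 (ha0 ℓ))
    -- the diagonal identity `Σ_m a_m ‖G m i‖² = a_i`
    have hdiag : ∀ i, ∑ m, a m * ‖G m i‖ ^ 2 = a i := by
      intro i
      have h := hent i i
      rw [if_pos rfl] at h
      have hterm : ∀ m, star (G m i) * ((a m : ℝ) : ℂ) * G m i = ((a m * ‖G m i‖ ^ 2 : ℝ) : ℂ) := by
        intro m
        rw [mul_comm (star _), mul_assoc, Complex.star_def, Complex.conj_mul']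
        push_cast
        ring
      simp_rw [hterm] at h
      rw [← Complex.ofReal_sum] at h
      exact_mod_cast h
    -- the bound off `ℓ`
    have hbd : ∀ m i, m ≠ ℓ → i ≠ ℓ → ‖G m i‖ ≤ A / μ := by
      intro m i hm hi
      have hsum' : ∑ m', (a m' * a i) * ‖G m' i‖ ^ 2 = a i * a i := by
        rw [← hdiag i, Finset.sum_mul]
        exact Finset.sum_congr rfl fun m' _ => by ring
      have hnonneg : ∀ m' ∈ (Finset.univ : Finset (Fin 3)), 0 ≤ (a m' * a i) * ‖G m' i‖ ^ 2 := by
        intro m' _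
        by_cases hm' : m' = ℓ
        · rw [hm', hrow i hi, norm_zero]; simp
        · exact mul_nonneg (hpos m' i hm' hi).le (sq_nonneg _)
      have hle : (a m * a i) * ‖G m i‖ ^ 2 ≤ a i * a i := by
        rw [← hsum']
        exact Finset.single_le_sum hnonneg (Finset.mem_univ m)
      have hc : μ ^ 2 ≤ a m * a i := by
        rw [← abs_of_pos (hpos m i hm hi), abs_mul, sq]
        exact mul_le_mul (hμle m) (hμle i) hμ0.le (abs_nonneg _)
      have h1 : (‖G m i‖ * μ) ^ 2 ≤ A ^ 2 :=
        calc (‖G m i‖ * μ) ^ 2 = ‖G m i‖ ^ 2 * μ ^ 2 := by ring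
          _ ≤ ‖G m i‖ ^ 2 * (a m * a i) := mul_le_mul_of_nonneg_left hc (sq_nonneg _)
          _ = (a m * a i) * ‖G m i‖ ^ 2 := by ring
          _ ≤ a i * a i := hle
          _ = |a i| ^ 2 := by rw [← sq, sq_abs]
          _ ≤ A ^ 2 := pow_le_pow_left₀ (abs_nonneg _) (hAle i) 2
      have h2 : ‖G m i‖ * μ ≤ A := (pow_le_pow_iff_left₀ (by positivity) hA0 two_ne_zero).1 h1
      exact (le_div_iff₀ hμ0).2 h2
    -- every entry is bounded by `B`
    intro m i
    show ‖G m i‖ ≤ B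
    by_cases hi : i = ℓ
    · rw [hi, hcol m]
      split_ifs
      · rw [norm_one]; exact le_max_left _ _
      · rw [norm_zero]; exact zero_le_one.trans (le_max_left _ _)
    · by_cases hm : m = ℓ
      · rw [hm, hrow i hi, norm_zero]; exact zero_le_one.trans (le_max_left _ _)
      · exact (hbd m i hm hi).trans (le_max_right _ _)

end Stabilizer

/-! ## §2 Uniform properness on `U₂` (slot `2` simple), modulo `chartTorusGLoc` -/

section Proper

variable (L : Type) [Field L] [NumberField L] [IsCMField L] (α : Fin 3 → L) (w : {w : InfinitePlace L // IsComplex w}) (S' : Finset {w : InfinitePlace L // IsComplex w})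

/-- `U₂ = {cw | ∀ j ≠ 2, e^{i cw 2} ≠ e^{i cw j}}` is open. [cite: Rogawski1990, §3.6 p. 28] -/
theorem isOpen_setOf_slot_two_simple : IsOpen {cw : Fin 3 → ℝ | ∀ j, j ≠ 2 → Circle.exp (cw 2) ≠ Circle.exp (cw j)} := by
  have e : {cw : Fin 3 → ℝ | ∀ j, j ≠ 2 → Circle.exp (cw 2) ≠ Circle.exp (cw j)} = ⋂ j : Fin 3, {cw : Fin 3 → ℝ | j ≠ 2 → Circle.exp (cw 2) ≠ Circle.exp (cw j)} := by
    ext cw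
    simp only [Set.mem_setOf_eq, Set.mem_iInter]
  rw [e]
  refine isOpen_iInter_of_finite fun j => ?_
  by_cases hj : j = 2
  · have : {cw : Fin 3 → ℝ | j ≠ 2 → Circle.exp (cw 2) ≠ Circle.exp (cw j)} = Set.univ := Set.eq_univ_of_forall fun _ h => absurd hj h
    rw [this]; exact isOpen_univ
  · have : {cw : Fin 3 → ℝ | j ≠ 2 → Circle.exp (cw 2) ≠ Circle.exp (cw j)} = {cw : Fin 3 → ℝ | Circle.exp (cw 2) ≠ Circle.exp (cw j)} :=
      Set.ext fun _ => ⟨fun h => h hj, fun h _ => h⟩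
    rw [this]
    exact isOpen_ne_fun (Circle.exp.continuous.comp (continuous_apply 2)) (Circle.exp.continuous.comp (continuous_apply j))

/-- **HARISH-CHANDRA'S COMPACTNESS LEMMA ACROSS THE COMPACT WALL, MODULO THE CHART TORUS** — the `hprop` binder of ★ `contDiffOn_chartOrbGLoc_of_uniformlyProper` VERBATIM on
`U₂ = {cw | ∀ j ≠ 2, e^{i cw 2} ≠ e^{i cw j}}` (slots `0, 1` may collide): for compact `K ⊆ U₂` and compact `C ⊆ U(α)_w` there is a compact `𝒦 ⊆ U(α)_w ⧸ chartTorusGLoc` containing the class of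
every `y` with `y · gprimeBlockAt α w S′ cw · y⁻¹ ∈ C`, `cw ∈ K`.  ★ D1c `exists_isCompact_mul_circleDiagonal_of_ne` at the odd line (`y ∈ C′ · Stab(e_ℓ)`), §1 (`Stab(e_ℓ)` compact),
`IsCompact.mul`, image under `mk`. [cite: Rogawski1990, §4.12 Lemma 4.12.1 p. 66; §8.2 pp. 114, 122–123] [cite: HarishChandra1970, Part I §3 Lemma 22] [cite: DeitmarEchterhoff2014, Lemma 9.3.3] -/
theorem uniformlyProper_gprimeBlockAt_cpt_of_slot_two_simple (hα : ∀ i, α i ≠ 0) (hreal : ∀ i, (w.1.embedding (α i)).im = 0)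
    (hw : ¬ (w ∈ S' ∧ w ∈ splitChartPlaces L α)) :
    ∀ K ⊆ {cw : Fin 3 → ℝ | ∀ j, j ≠ 2 → Circle.exp (cw 2) ≠ Circle.exp (cw j)}, IsCompact K →
      ∀ C : Set ↥(archLocal L 3 (Matrix.diagonal α) w), IsCompact C →
        ∃ 𝒦 : Set (↥(archLocal L 3 (Matrix.diagonal α) w) ⧸ chartTorusGLoc L α w S'), IsCompact 𝒦 ∧
          ∀ cw ∈ K, ∀ y : ↥(archLocal L 3 (Matrix.diagonal α) w), y * gprimeBlockAt L α w S' cw * y⁻¹ ∈ C →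
            (QuotientGroup.mk y : ↥(archLocal L 3 (Matrix.diagonal α) w) ⧸ chartTorusGLoc L α w S') ∈ 𝒦 := by
  intro K hK hKc C hC
  set τ : Fin 3 ≃ Fin 3 := lineOf (formSign L α w) with hτ
  set φ : (Fin 3 → ℝ) → (Fin 3 → Circle) := fun cw ℓ' => Circle.exp (cw (τ.symm ℓ')) with hφ
  have hφc : Continuous φ := continuous_pi fun ℓ' => Circle.exp.continuous.comp (continuous_apply _)
  have hKS : φ '' K ⊆ {z : Fin 3 → Circle | ∀ j, j ≠ τ 2 → z (τ 2) ≠ z j} := by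
    rintro z ⟨cw, hcw, rfl⟩ j hj
    simp only [hφ]
    rw [Equiv.symm_apply_apply]
    exact hK hcw _ fun h => hj (by rw [← h, Equiv.apply_symm_apply])
  set M : Subgroup ↥(archLocal L 3 (Matrix.diagonal α) w) := MulAction.stabilizer ↥(archLocal L 3 (Matrix.diagonal α) w) (Pi.single (τ 2) (1 : ℂ) : Fin 3 → ℂ) with hM
  obtain ⟨C', hC'c, hC'⟩ := exists_isCompact_mul_circleDiagonal_of_ne L 3 α w hα hreal (τ 2) M le_rfl hKS (hKc.image hφc) hC
  have hSc : IsCompact (M : Set ↥(archLocal L 3 (Matrix.diagonal α) w)) := isCompact_stabilizer_single_lineOf_two L α w hα hreal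
  have hprod : IsCompact (C' * (M : Set ↥(archLocal L 3 (Matrix.diagonal α) w))) := hC'c.mul hSc
  refine ⟨QuotientGroup.mk '' (C' * (M : Set ↥(archLocal L 3 (Matrix.diagonal α) w))), hprod.image continuous_quot_mk, fun cw hcw y hy => ?_⟩
  refine Set.mem_image_of_mem _ (hC' (φ cw) ⟨cw, hcw, rfl⟩ y ?_)
  have heq : gprimeBlockAt L α w S' cw = ⟨circleDiagonal 3 (φ cw), circleDiagonal_mem_archLocal_diagonal L 3 α w (φ cw)⟩ := by
    show gprimeBlock L α w S' (fun _ => cw) = _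
    rw [gprimeBlock_const_eq_circleDiagonal L α S' hw cw]
  rw [heq] at hy
  exact hy

end Proper

/-! ## §3 Corollaries: smoothness and positivity of the one-place functional on `U₂` -/

section Corollaries

variable (L : Type) [Field L] [NumberField L] [IsCMField L] (α : Fin 3 → L) (w : {w : InfinitePlace L // IsComplex w}) (S' : Finset {w : InfinitePlace L // IsComplex w})
  [MeasurableSpace ↥(archLocal L 3 (Matrix.diagonal α) w)] [BorelSpace ↥(archLocal L 3 (Matrix.diagonal α) w)]
  (νw : Measure ↥(archLocal L 3 (Matrix.diagonal α) w)) [νw.IsHaarMeasure] [νw.IsMulRightInvariant]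

/-- **AT A COMPACT-CHART PLACE THE ONE-PLACE FUNCTIONAL IS `C^∞` ON `U₂`, I.E. ACROSS THE COMPACT WALL** `e^{i cw 0} = e^{i cw 1}` (slot `2` simple): ★ engine
`contDiffOn_chartOrbGLoc_of_uniformlyProper` fed by §2. [cite: Rogawski1990, §8.2 pp. 122–123; §8.3 pp. 122–124] [cite: Shelstad1979, §4 pp. 22–23] -/
theorem contDiffOn_chartOrbGLoc_cpt_of_slot_two_simple (hα : ∀ i, α i ≠ 0) (hreal : ∀ i, (w.1.embedding (α i)).im = 0)
    (hw : ¬ (w ∈ S' ∧ w ∈ splitChartPlaces L α))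
    {f : ↥(archLocal L 3 (Matrix.diagonal α) w) → ℂ} (fa : Matrix (Fin 3) (Fin 3) ℂ → ℂ) (hfa : ContDiff ℝ ∞ fa)
    (hf : ∀ g : ↥(archLocal L 3 (Matrix.diagonal α) w), f g = fa (((g : GL (Fin 3) ℂ)) : Matrix (Fin 3) (Fin 3) ℂ)) (hfc : HasCompactSupport f) :
    ContDiffOn ℝ ∞ (chartOrbGLoc L α w S' νw f) {cw : Fin 3 → ℝ | ∀ j, j ≠ 2 → Circle.exp (cw 2) ≠ Circle.exp (cw j)} :=
  contDiffOn_chartOrbGLoc_of_uniformlyProper L α w S' νw (isOpen_setOf_slot_two_simple)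
    (fun K hK hKc C hC => uniformlyProper_gprimeBlockAt_cpt_of_slot_two_simple L α w S' hα hreal hw K hK hKc C hC) fa hfa hf hfc

/-- **POSITIVITY AT A POINT OF `U₂`** (compact-chart place `w ∉ S′`, admissible `S′`, `f ≥ 0` continuous with compact support and `f (gprimeBlockAt α w S′ cw) > 0`): the ★ proof of
`chartOrbGLoc_ofReal_re_pos` with §2 supplying the integrability (★ `integrable_descConj_of_uniformlyProper`). [cite: Rogawski1990, §8.2 p. 122] [cite: DeitmarEchterhoff2014, Thm. 1.5.3] -/
theorem chartOrbGLoc_ofReal_re_pos_of_slot_two_simple (hα : ∀ i, α i ≠ 0) (hreal : ∀ i, (w.1.embedding (α i)).im = 0)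
    (hS' : ∀ w, w ∈ S' → w ∈ splitChartPlaces L α) (hw : w ∉ S')
    {f : ↥(archLocal L 3 (Matrix.diagonal α) w) → ℝ} (hf : Continuous f) (hfc : HasCompactSupport f) (h0 : ∀ g, 0 ≤ f g) {cw : Fin 3 → ℝ}
    (hcw : ∀ j, j ≠ 2 → Circle.exp (cw 2) ≠ Circle.exp (cw j)) (hpos : 0 < f (gprimeBlockAt L α w S' cw)) :
    0 < (chartOrbGLoc L α w S' νw (fun g => ((f g : ℝ) : ℂ)) cw).re := by
  letI : MeasurableSpace (↥(archLocal L 3 (Matrix.diagonal α) w) ⧸ chartTorusGLoc L α w S') := borel _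
  haveI : BorelSpace (↥(archLocal L 3 (Matrix.diagonal α) w) ⧸ chartTorusGLoc L α w S') := ⟨rfl⟩
  haveI := locallyCompactSpace_archLocal_three L α w
  haveI := secondCountableTopology_archLocal_three L α w
  haveI := locallyCompactSpace_chartTorusGLoc L α w S'
  haveI := isHaarMeasure_chartHaarGLoc L α w S'
  haveI := isInvInvariant_chartHaarGLoc L α w S'
  rw [chartOrbGLoc_ofReal, Complex.ofReal_re]
  have hopen : (chartQuotientMeasureGLoc L α w S' νw).IsOpenPosMeasure := by
    unfold chartQuotientMeasureGLoc
    exact isOpenPosMeasure_quotientMeasure (chartTorusGLoc L α w S') (isClosed_chartTorusGLoc L α w S') (chartHaarGLoc L α w S') νw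
  haveI := hopen
  haveI : IsFiniteMeasureOnCompacts (chartQuotientMeasureGLoc L α w S' νw) := by
    unfold chartQuotientMeasureGLoc
    infer_instance
  have hw' : ¬ (w ∈ S' ∧ w ∈ splitChartPlaces L α) := fun h => hw h.1
  have hint : Integrable (descConj (gprimeBlockAt L α w S' cw) (chartTorusGLoc L α w S') (forall_mem_chartTorusGLoc_comm L α w S' cw) f)
      (chartQuotientMeasureGLoc L α w S' νw) :=
    integrable_descConj_of_uniformlyProper (chartTorusGLoc L α w S') (forall_mem_chartTorusGLoc_comm L α w S')
      (fun K hK hKc C hC => uniformlyProper_gprimeBlockAt_cpt_of_slot_two_simple L α w S' hα hreal hw' K hK hKc C hC)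
      (chartQuotientMeasureGLoc L α w S' νw) hf hfc hcw
  have hbox : 0 < (chartHaarGLoc L α w S' (chartBoxImgGLoc L α w S')).toReal := by
    have hm : 0 < chartHaarGLoc L α w S' (chartBoxImgGLoc L α w S') := by
      rw [chartBoxImgGLoc_eq_univ_of_not_mem L α w S' hα hS' hw]
      exact isOpen_univ.measure_pos _ Set.univ_nonempty
    exact ENNReal.toReal_pos hm.ne' (chartHaarGLoc_chartBoxImgGLoc_lt_top L α w S').ne
  refine mul_pos hbox ?_
  exact integral_descConj_pos_of_nonneg (gprimeBlockAt L α w S' cw) (chartTorusGLoc L α w S') (forall_mem_chartTorusGLoc_comm L α w S' cw)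
    (chartQuotientMeasureGLoc L α w S' νw) hf h0 hint (x₀ := 1) (by simpa using hpos.ne')

end Corollaries

end Literature.NumberTheory.Automorphic.UnitaryGroup

end
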